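import Summits.PneNP.PneNP.Theorems.SymmetryBudgetNoHiddenOrderPerPathCGBudget

/-!
# Counting the budgeted labels (`NoHiddenOrder`, glue g3c): `2^{O(|V|)}` pairs `(X, λ)`

Route `PneNP/SymmetryBudget`, `NoHiddenOrder` (stmt-PneNP-14781). `…PerPathCGBudget.lean` shows that every label `(block, X, λ)` of the
solution subtree of the certified scheme on the concrete process satisfies `BudgetBound X λ` (values below numbers `d k` with
`Σ ⌊log₂ d k⌋ ≤ B := 4|V| + ⌊log₂|V|⌋`, `λ = 0` off `X`). Here the purely combinatorial consequence the circuit-size bound needs: the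
pairs `(X, λ)` with `BudgetBound X λ` lie in an explicit finite set of size `2^{O(|V|)}`:

* write `λ y + 1 = 2^{p y} + o y` with the PROFILE `p y := ⌊log₂ (λ y + 1)⌋` (`Σ_y p y ≤ B`) and the OFFSET `o y < 2^{p y}`; the pair
  is DECODED from `(X, p, o)` (`decode_prof_offs`), so the budgeted pairs are covered by the image of
  `powerset × Σ_{p : profile} Π_y [0, 2^{p y})` (`budgetCover`, `mem_budgetCover_of_budgetBound`);
* that set has `≤ 2^n · (B+1) · 2^{n+B} · 2^B` elements (`card_budgetCover_le`): profiles of total mass `s` are `s`-multisets of `V`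
  (`Sym.equivNatSumOfFintype`, stars and bars `Sym.card_sym_eq_choose ≤ 2^{n+s}`), offsets under a profile of mass `s` number `2^s`.
With `B = 4n + ⌊log₂ n⌋` this is `2^{11 n + O(log n)}` = `m^{11+o(1)}` for the window `n = ⌊log₂ m⌋` (`card_budgetLabels_le`).
-/

-- `Summit.PneNP.PneNP.…` duplicates `PneNP` BY DESIGN (single-problem summit, D-0017 layout).
set_option linter.dupNamespace false

namespace Summit.PneNP.PneNP.Theorems

open Finset

namespace BranchSum

variable {V : Type*} [Fintype V] [DecidableEq V]

/-! ### Profile and offset of a label -/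

/-- The PROFILE of `λ` on `X`: `⌊log₂ (λ y + 1)⌋` on `X`, `0` elsewhere. -/
def prof (X : Finset V) (lam : V → ℕ) (y : V) : ℕ := if y ∈ X then Nat.log 2 (lam y + 1) else 0

/-- The OFFSET of `λ` on `X`: `λ y + 1 − 2^{profile}` on `X`, `0` elsewhere. -/
def offs (X : Finset V) (lam : V → ℕ) (y : V) : ℕ := if y ∈ X then lam y + 1 - 2 ^ prof X lam y else 0

/-- DECODING a pair from `(X, profile, offset)`. -/
def decodeLam (X : Finset V) (p o : V → ℕ) (y : V) : ℕ := if y ∈ X then 2 ^ p y + o y - 1 else 0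

omit [Fintype V] in
/-- The offset is below `2^{profile}`. -/
theorem offs_lt (X : Finset V) (lam : V → ℕ) (y : V) : offs X lam y < 2 ^ prof X lam y := by
  unfold offs prof
  split_ifs with hy
  · have h1 : lam y + 1 < 2 ^ (Nat.log 2 (lam y + 1) + 1) := Nat.lt_pow_succ_log_self (by norm_num) _
    have h2 : 2 ^ Nat.log 2 (lam y + 1) ≤ lam y + 1 := Nat.pow_log_le_self 2 (Nat.succ_ne_zero _)
    rw [pow_succ] at h1
    omega
  · exact Nat.one_le_two_pow

omit [Fintype V] in
/-- Decoding recovers a label vanishing off `X`. -/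
theorem decode_prof_offs {X : Finset V} {lam : V → ℕ} (h0 : ∀ y, y ∉ X → lam y = 0) :
    decodeLam X (prof X lam) (offs X lam) = lam := by
  funext y
  unfold decodeLam offs
  split_ifs with hy
  · have h2 : 2 ^ prof X lam y ≤ lam y + 1 := by
      unfold prof; rw [if_pos hy]; exact Nat.pow_log_le_self 2 (Nat.succ_ne_zero _)
    omega
  · exact (h0 y hy).symm

/-- The total profile of a budgeted label is within the budget. -/
theorem sum_prof_le {X : Finset V} {lam : V → ℕ} {B : ℕ} {t : ℕ} {x : ℕ → V} {d : ℕ → ℕ} (hinj : Set.InjOn x ↑(range t))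
    (hX : X = (range t).image x) (hlam : ∀ k, k < t → lam (x k) + 1 ≤ d k) (hsum : ∑ k ∈ range t, Nat.log 2 (d k) ≤ B) :
    ∑ y, prof X lam y ≤ B := by
  have h1 : ∑ y, prof X lam y = ∑ y ∈ X, Nat.log 2 (lam y + 1) := by
    unfold prof
    rw [← sum_filter, filter_mem_eq_inter, univ_inter]
  rw [h1, hX, sum_image fun i hi j hj hij => hinj hi hj hij]
  refine le_trans (sum_le_sum fun k hk => ?_) hsum
  exact Nat.log_mono_right (hlam k (mem_range.1 hk))

/-! ### The cover and its size -/

variable (V)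

/-- Profiles of total mass `≤ B` (inside the box `[0, B]^V`). -/
def profiles (B : ℕ) : Finset (V → ℕ) := (Fintype.piFinset fun _ : V => range (B + 1)).filter fun p => ∑ y, p y ≤ B

/-- **The cover of the budgeted labels**: decode every `(X, p, o)` with `p` a profile of mass `≤ B` and `o y < 2^{p y}`. -/
noncomputable def budgetCover (B : ℕ) : Finset (Finset V × (V → ℕ)) :=
  ((univ : Finset V).powerset ×ˢ (profiles V B).sigma fun p => Fintype.piFinset fun y => range (2 ^ p y)).image
    fun q => (q.1, decodeLam q.1 q.2.1 q.2.2)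

variable {V}

/-- **Budgeted labels are covered.** -/
theorem mem_budgetCover_of_budgetBound {B : ℕ} {X : Finset V} {lam : V → ℕ} {t : ℕ} {x : ℕ → V} {d : ℕ → ℕ}
    (hinj : Set.InjOn x ↑(range t)) (hX : X = (range t).image x) (hlam : ∀ k, k < t → lam (x k) + 1 ≤ d k)
    (hsum : ∑ k ∈ range t, Nat.log 2 (d k) ≤ B) (h0 : ∀ y, y ∉ X → lam y = 0) : (X, lam) ∈ budgetCover V B := by
  have hs := sum_prof_le hinj hX hlam hsum
  unfold budgetCover
  rw [mem_image]
  refine ⟨(X, ⟨prof X lam, offs X lam⟩), ?_, ?_⟩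
  · rw [mem_product, mem_sigma]
    refine ⟨mem_powerset.2 (subset_univ _), ?_, ?_⟩
    · unfold profiles
      rw [mem_filter, Fintype.mem_piFinset]
      refine ⟨fun y => mem_range.2 (Nat.lt_succ_of_le ?_), hs⟩
      exact (single_le_sum (f := prof X lam) (fun _ _ => Nat.zero_le _) (mem_univ y)).trans hs
    · rw [Fintype.mem_piFinset]
      exact fun y => mem_range.2 (offs_lt X lam y)
  · simp only [decode_prof_offs h0]

/-- Profiles of exact mass `s` are counted by `s`-multisets of `V` (stars and bars). -/
theorem card_profiles_fiber_le (B s : ℕ) :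
    ((profiles V B).filter fun p => ∑ y, p y = s).card ≤ (Fintype.card V + s - 1).choose s := by
  classical
  rw [← Sym.card_sym_eq_choose, ← card_univ]
  by_cases hV : Nonempty (Sym V s)
  · obtain ⟨z⟩ := hV
    refine card_le_card_of_injOn (fun p => if h : ∑ y, p y = s then (Sym.equivNatSumOfFintype V s).symm ⟨p, h⟩ else z)
      (fun _ _ => mem_coe.2 (mem_univ _)) fun p hp p' hp' hpp => ?_
    have h1 : ∑ y, p y = s := (mem_filter.1 (mem_coe.1 hp)).2
    have h2 : ∑ y, p' y = s := (mem_filter.1 (mem_coe.1 hp')).2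
    simp only [h1, h2, dif_pos] at hpp
    have := (Sym.equivNatSumOfFintype V s).symm.injective hpp
    exact congrArg Subtype.val this
  · -- no multisets of size `s`: then no profile of mass `s` either
    have hempty : ((profiles V B).filter fun p => ∑ y, p y = s) = ∅ := by
      rw [filter_eq_empty_iff]
      intro p _ hps
      exact hV ⟨(Sym.equivNatSumOfFintype V s).symm ⟨p, hps⟩⟩
    rw [hempty, card_empty]
    exact Nat.zero_le _

/-- Stars and bars, crudely: `C(n+s-1, s) ≤ 2^{n+s}`. -/
theorem choose_stars_le (n s : ℕ) : (n + s - 1).choose s ≤ 2 ^ (n + s) := by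
  by_cases h : s ≤ n + s - 1
  · calc (n + s - 1).choose s ≤ ∑ k ∈ range (n + s - 1 + 1), (n + s - 1).choose k :=
          single_le_sum (f := fun k => (n + s - 1).choose k) (fun _ _ => Nat.zero_le _) (mem_range.2 (Nat.lt_succ_of_le h))
      _ = 2 ^ (n + s - 1) := Nat.sum_range_choose _
      _ ≤ 2 ^ (n + s) := Nat.pow_le_pow_right (by norm_num) (Nat.sub_le _ _)
  · rw [Nat.choose_eq_zero_of_lt (by omega)]
    exact Nat.zero_le _

/-- The number of profiles of mass `≤ B`. -/
theorem card_profiles_le (B : ℕ) : (profiles V B).card ≤ (B + 1) * 2 ^ (Fintype.card V + B) := by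
  have hcover : profiles V B = (range (B + 1)).biUnion fun s => (profiles V B).filter fun p => ∑ y, p y = s := by
    ext p
    simp only [mem_biUnion, mem_range, mem_filter]
    constructor
    · intro hp
      have hs : ∑ y, p y ≤ B := by unfold profiles at hp; exact (mem_filter.1 hp).2
      exact ⟨_, Nat.lt_succ_of_le hs, hp, rfl⟩
    · rintro ⟨s, -, hp, -⟩; exact hp
  rw [hcover]
  refine (card_biUnion_le).trans ?_
  calc ∑ s ∈ range (B + 1), ((profiles V B).filter fun p => ∑ y, p y = s).card
      ≤ ∑ s ∈ range (B + 1), 2 ^ (Fintype.card V + B) := sum_le_sum fun s hs => by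
        refine (card_profiles_fiber_le B s).trans ((choose_stars_le _ s).trans ?_)
        exact Nat.pow_le_pow_right (by norm_num) (by have := mem_range.1 hs; omega)
    _ = (B + 1) * 2 ^ (Fintype.card V + B) := by rw [sum_const, card_range, smul_eq_mul]

/-- **The size of the cover**: `≤ 2^n · ((B+1) · 2^{n+B}) · 2^B`. -/
theorem card_budgetCover_le (B : ℕ) :
    (budgetCover V B).card ≤ 2 ^ Fintype.card V * ((B + 1) * 2 ^ (Fintype.card V + B)) * 2 ^ B := by
  unfold budgetCover
  refine card_image_le.trans ?_
  rw [card_product, card_powerset, card_univ, card_sigma, mul_assoc]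
  refine Nat.mul_le_mul_left _ ?_
  calc ∑ p ∈ profiles V B, (Fintype.piFinset fun y => range (2 ^ p y)).card
      = ∑ p ∈ profiles V B, 2 ^ ∑ y, p y := sum_congr rfl fun p _ => by
        rw [Fintype.card_piFinset]
        simp only [card_range]
        exact prod_pow_eq_pow_sum _ _ _
    _ ≤ ∑ _p ∈ profiles V B, 2 ^ B := sum_le_sum fun p hp => by
        unfold profiles at hp
        exact Nat.pow_le_pow_right (by norm_num) (mem_filter.1 hp).2
    _ = (profiles V B).card * 2 ^ B := by rw [sum_const, smul_eq_mul]
    _ ≤ (B + 1) * 2 ^ (Fintype.card V + B) * 2 ^ B := Nat.mul_le_mul_right _ (card_profiles_le B)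

/-! ### The budgeted labels of the scheme -/

/-- **The pairs `(X, λ)` with `BudgetBound X λ` lie in a set of size `2^{O(|V|)}`**: with `n := |V|` and `B := 4n + ⌊log₂ n⌋`,
at most `2^n · (B+1) · 2^{n+B} · 2^B` of them. -/
theorem card_budgetLabels_le :
    ∃ Λ : Finset (Finset V × (V → ℕ)), (∀ X lam, BudgetBound X lam → (X, lam) ∈ Λ) ∧
      Λ.card ≤ 2 ^ Fintype.card V * ((4 * Fintype.card V + Nat.log 2 (Fintype.card V) + 1) *
        2 ^ (Fintype.card V + (4 * Fintype.card V + Nat.log 2 (Fintype.card V)))) *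
        2 ^ (4 * Fintype.card V + Nat.log 2 (Fintype.card V)) := by
  refine ⟨budgetCover V (4 * Fintype.card V + Nat.log 2 (Fintype.card V)), fun X lam hB => ?_, card_budgetCover_le _⟩
  obtain ⟨t, x, d, -, hinj, hX, hlam, hsum, h0⟩ := hB
  exact mem_budgetCover_of_budgetBound hinj hX hlam hsum h0

end BranchSum

end Summit.PneNP.PneNP.Theorems
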